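import Literature.AlgebraicGeometry.Surfaces.K3NikulinInvolution
import Literature.AlgebraicGeometry.Surfaces.K3Marking
import Literature.AlgebraicGeometry.Surfaces.K3PeriodSurjectivityProofs
import HarnessLib

/-!
# The action of a Nikulin involution on `H²(X, ℤ)` read in a marking: an isometric involution of
# `Λ_{K3}`, and transport along `O(Λ_{K3})`
# (van Geemen–Sarti 2007 §1.1–1.2; Huybrechts, *Lectures on K3 Surfaces*, Ch. 15 Thm. 3.13, Ch. 6 §3.2)

Family `hodge`, layer `Literature/AlgebraicGeometry/Surfaces`. Companion (proof file) of
`K3NikulinInvolution.lean`, working towards its named fact `Nikulin_involution_marking`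
(van Geemen–Sarti §1.2: for a K3 surface `S` with a Nikulin involution `ι` there is a marking
`φ : H²(S(ℂ); ℂ) ≅ Λ_ℂ` in which `ι^*` is the swap of the two `E₈(−1)` blocks of
`Λ_{K3} = E₈(−1)^{⊕2} ⊕ U^{⊕3}`). Everything here is PROVED; no named fact is introduced (D-0026).
(The sibling proof file `K3NikulinInvolutionProofs.lean` works towards the other fact of that file,
`Nikulin_involution_eight_fixedPoints`.)

## The printed proof and what this file covers

Van Geemen–Sarti, *Nikulin involutions on K3 surfaces* (held text `paper:arxiv-math_0602015`,
p. 3, read this session), §1.1: "Nikulin proved that any abelian group `G` which acts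
symplectically on a K3 surface has a unique, up to isometry, action on `H²(X,ℤ)`" (Nikulin 1979,
Thm. 4.7; = Huybrechts Ch. 15 Thm. 3.13: "the induced action on the abstract lattice `H²(X,ℤ)` is
unique up to orthogonal transformations", stated there without proof); §1.2: "D. Morrison observed
that there exist K3 surfaces with a Nikulin involution which acts in the following way …
`(u,x,y) ↦ (u,y,x)`. Thus for any K3 surface `X` with a Nikulin involution `ι` there is an
isomorphism `H²(X,ℤ) ≅ U³ ⊕ E₈(−1) ⊕ E₈(−1)` such that `ι^*` acts as above."

So the printed proof has three inputs — (M) a marking of the given `X` (Huybrechts Ch. 1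
Prop. 3.5, the tree's named fact `Huybrechts_K3_marking_exists`), (N) Nikulin's uniqueness of the
action up to `O(Λ_{K3})`, (E) Morrison's model — and one formal step, the transport "Thus …". This
file proves the transport step and everything about the action that the tree's carriers give today:

* `isIntegralClass_complexBetti_map` — `f^*` preserves integral classes (Hatcher §3.1);
* `exists_intMatrix_map_of_marking` — in a marking `η` (integral classes `↔ ℤ²²`), `f^*` on
  `H²(S(ℂ); ℂ)` is an INTEGRAL matrix `g`: `η (f^* c) = g (η c)`;
* `IsNikulinInvolution.exists_latticeInvolution` — for a Nikulin involution `ι` and a marking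
  `(η, p, x)` with the clauses of `Huybrechts_K3_marking_exists`, that matrix is an isometric
  involution of `Λ_{K3}` fixing the period: `g² = 1` (`ι² = 1`), `g x = x` (`ι` symplectic,
  `η⁻¹ x ∈ H^{2,0}`), `gᵀ Λ g = Λ` (naturality of the cup product gives `(g v.g w) p = (v.w) ι^* p`
  with `ι^* p = n p`, and `n = 1` since `g` fixes `x`, `x̄` and `(x̄.x) ≠ 0`) — this `g` is the
  object whose conjugacy class (N) + (E) determine;
* `exists_marking_comp_latticeIsometry` — markings compose with `O(Λ_{K3})` (Huybrechts Ch. 6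
  §3.2: `(X, φ) ↦ (X, γ ∘ φ)`), using the tree's `isUnit_of_k3Isometry`,
  `k3Form_mulVec_mulVec_of_isometry`;
* `Nikulin_involution_marking_of_conjugate` — the transport step: a marking in which `ι^*` is
  `O(Λ_{K3})`-conjugate to the block swap yields one in which it IS the swap; an equivalence
  (`Nikulin_involution_marking_iff_exists_conjugate`, converse with `γ = 1`);
* `Nikulin_involution_marking_of_latticeConjugacy` — the census BY NAME: granted
  `Huybrechts_K3_marking_exists` and, for the isometric involution `g` above, a `γ ∈ O(Λ_{K3})`
  with `γ g = swap ∘ γ` ((N) + (E) in coordinates), the fact `Nikulin_involution_marking` holds.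

Deliberately NOT here (not supported by the tree; recorded in the seat's notes): (N) and (E)
themselves — Nikulin's proof goes through the quotient `X/ι` and its minimal resolution, the eight
fixed points (the undischarged `Nikulin_involution_eight_fixedPoints`; no Lefschetz fixed point
formula in the tree), `(H²(X,ℤ)^ι)^⊥ ≅ E₈(−2)`, and the discriminant-form technique / uniqueness
of the primitive embedding `E₈(−2) ↪ Λ_{K3}` (Nikulin 1980 Thm. 1.14.4); Morrison's existence goes
through the Torelli theorem. Neither is the discharge of `Huybrechts_K3_marking_exists` (see
`K3MarkingProofs.lean` for its own census).

## References

* [VanGeemenSarti2007] B. van Geemen, A. Sarti, Nikulin involutions on K3 surfaces, Math. Z. 255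
  (2007) 731–753 = arXiv:math/0602015, §1.1 (Nikulin's uniqueness result), §1.2 (action on
  cohomology).
* [Morrison1984] D. R. Morrison, On K3 surfaces with large Picard number, Invent. Math. 75 (1984),
  Thm. 5.7.
* [Huybrechts2016K3] D. Huybrechts, Lectures on K3 Surfaces, CUP 2016, Ch. 1 Prop. 3.5 (markings),
  Ch. 6 §3.2 (the action of `O(Λ)` on marked K3 surfaces), Ch. 15 §1.2 and Thm. 3.13 (Nikulin).
* [HatcherAT2002] A. Hatcher, Algebraic Topology, CUP 2002, §3.1 p. 198 (change of coefficients),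
  Prop. 3.10 (naturality of the cup product).
* V. V. Nikulin, Finite groups of automorphisms of Kählerian K3 surfaces, Trudy Moskov. Mat.
  Obshch. 38 (1979), Thm. 4.7 — cited through the sources above.
-/

noncomputable section

open CategoryTheory
open Literature.AlgebraicTopology.SingularHomology

namespace Literature.AlgebraicGeometry.Surfaces

variable {S : Motives.SchemeOver ℂ}

/-! ### The action in a marking and the transport step -/

section Transport

open scoped Matrix

/-- Integral classes pull back to integral classes along `f^*` for a `ℂ`-morphism `f` (a `ℤ`-valued
cocycle pulls back to a `ℤ`-valued cocycle; Hatcher §3.1). [cite: HatcherAT2002, §3.1 p. 198] -/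
theorem isIntegralClass_complexBetti_map {S' : Motives.SchemeOver ℂ} (f : S ⟶ S') {k : ℕ}
    {c : HodgeTheory.complexBetti S' k} (hc : HodgeTheory.IsIntegralClass c) :
    HodgeTheory.IsIntegralClass (HodgeTheory.complexBetti.map f k c) := by
  obtain ⟨z, rfl, hz⟩ := hc
  refine ⟨singularCochainComplex.cocyclesMap ℂ ℂ _ k z, (singularCohomology.map_π _ z).symm,
    fun σ => ?_⟩
  rw [singularCochainComplex.iCocycles_cocyclesMap]
  exact hz (σ.map _)

/-- The K3 form of two matrix images: `(M v.M w) = v ⬝ (Mᵀ Λ M) w`. [folklore] -/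
theorem k3Form_mulVec_mulVec (M : Matrix K3Index K3Index ℂ) (v w : K3Index → ℂ) :
    k3Form (M *ᵥ v) (M *ᵥ w) = v ⬝ᵥ ((Mᵀ * k3Gram.map (Int.cast : ℤ → ℂ) * M) *ᵥ w) := by
  rw [k3Form_eq_dotProduct, ← Matrix.vecMul_transpose M v]
  simp only [Matrix.dotProduct_mulVec, Matrix.vecMul_vecMul, Matrix.mul_assoc]

/-- **The action of an endomorphism on `H²` is an integral matrix in any marking.** If `η`
identifies the integral classes of `H²(S(ℂ); ℂ)` with `ℤ²²`, then for every endomorphism `f` of `S`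
there is an integral matrix `g` with `η (f^* c) = g (η c)` for all classes `c` (`f^*` preserves
integral classes and is `ℂ`-linear; compare on the basis `η⁻¹ e_j`).
[cite: Huybrechts2016K3, Ch. 15 §1.2 (the action on `H^*(X, ℤ)`)] -/
theorem exists_intMatrix_map_of_marking (f : S ⟶ S)
    (η : HodgeTheory.complexBetti S (2 * 1) ≃ₗ[ℂ] (K3Index → ℂ))
    (hint : ∀ c : HodgeTheory.complexBetti S (2 * 1),
      HodgeTheory.IsIntegralClass c ↔ ∃ v : K3Index → ℤ, η c = fun i => (v i : ℂ)) :
    ∃ g : Matrix K3Index K3Index ℤ, ∀ c : HodgeTheory.complexBetti S (2 * 1),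
      η (HodgeTheory.complexBetti.map f (2 * 1) c) = g.map (Int.cast : ℤ → ℂ) *ᵥ η c := by
  classical
  have hcol : ∀ j : K3Index, ∃ v : K3Index → ℤ,
      η (HodgeTheory.complexBetti.map f (2 * 1) (η.symm (Pi.single j 1))) = fun i => (v i : ℂ) := by
    intro j
    refine (hint _).1 (isIntegralClass_complexBetti_map f ((hint _).2 ⟨Pi.single j 1, ?_⟩))
    rw [LinearEquiv.apply_symm_apply]
    funext i
    by_cases h : i = j
    · subst h; simp
    · simp [h]
  choose col hcol using hcol
  refine ⟨Matrix.of fun i j => col j i, fun c => ?_⟩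
  set M : Matrix K3Index K3Index ℤ := Matrix.of fun i j => col j i with hM
  -- both sides are `ℂ`-linear in `η c`; compare on the standard basis of `Λ_ℂ`
  let L : (K3Index → ℂ) →ₗ[ℂ] (K3Index → ℂ) :=
    η.toLinearMap ∘ₗ (HodgeTheory.complexBetti.map f (2 * 1)).hom ∘ₗ η.symm.toLinearMap
  have hL : ∀ v, L v = η (HodgeTheory.complexBetti.map f (2 * 1) (η.symm v)) := fun v => rfl
  have hLM : L = Matrix.toLin' (M.map (Int.cast : ℤ → ℂ)) := by
    refine (Pi.basisFun ℂ K3Index).ext fun j => ?_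
    rw [Pi.basisFun_apply, hL, hcol, Matrix.toLin'_apply, Matrix.mulVec_single_one]
    funext i
    rw [Matrix.col_apply, Matrix.map_apply, hM, Matrix.of_apply]
  have h := congrArg (fun T : (K3Index → ℂ) →ₗ[ℂ] (K3Index → ℂ) => T (η c)) hLM
  simp only [hL, LinearEquiv.symm_apply_apply, Matrix.toLin'_apply] at h
  exact h

/-- **The action of a Nikulin involution on `H²(X, ℤ)`, in a marking, is an isometric involution of
`Λ_{K3}` fixing the period** — the object whose `O(Λ_{K3})`-conjugacy class Nikulin's uniqueness
theorem determines (van Geemen–Sarti §1.1–1.2; Huybrechts Ch. 15 §1.2 and Thm. 3.13). For a marked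
K3 surface `(S, η, p, x)` with the clauses of `Huybrechts_K3_marking_exists` and a Nikulin involution
`ι`: the matrix `g` of `ι^*` satisfies `g² = 1` (`ι² = 1`), `g x = x` (`ι` is symplectic and
`η⁻¹ x` is of type `(2,0)`), and `gᵀ Λ g = Λ` — from `ι^*(a ∪ b) = ι^* a ∪ ι^* b` (naturality of
the cup product) one gets `(g v.g w) p = (v.w) ι^* p` with `ι^* p = n p` (`ι^* p` is integral), and
`n = 1` because the real matrix `g` fixes `x` and `x̄` while `(x̄.x) ≠ 0`.
[cite: VanGeemenSarti2007, §1.1 and §1.2] [cite: Huybrechts2016K3, Ch. 15 §1.2 and Thm. 3.13] -/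
theorem IsNikulinInvolution.exists_latticeInvolution {ι : S ⟶ S} (hι : IsNikulinInvolution S ι)
    (η : HodgeTheory.complexBetti S (2 * 1) ≃ₗ[ℂ] (K3Index → ℂ))
    (p : HodgeTheory.complexBetti S (2 * 2)) (x : K3Index → ℂ) (hp0 : p ≠ 0)
    (hp : HodgeTheory.IsIntegralClass p)
    (hgen : ∀ q : HodgeTheory.complexBetti S (2 * 2), HodgeTheory.IsIntegralClass q → ∃ n : ℤ, q = n • p)
    (hint : ∀ c : HodgeTheory.complexBetti S (2 * 1),
      HodgeTheory.IsIntegralClass c ↔ ∃ v : K3Index → ℤ, η c = fun i => (v i : ℂ))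
    (hcup : ∀ a b : HodgeTheory.complexBetti S (2 * 1),
      cupProduct (rfl : 2 * 1 + 2 * 1 = 2 * 2) a b = k3Form (η a) (η b) • p)
    (h20 : HodgeTheory.IsOfHodgeType 2 S (2 * 1) 2 0 (LinearEquiv.symm η x))
    (hxpos : 0 < (k3Form (star x) x).re) :
    ∃ g : Matrix K3Index K3Index ℤ,
      (∀ c : HodgeTheory.complexBetti S (2 * 1),
        η (HodgeTheory.complexBetti.map ι (2 * 1) c) = g.map (Int.cast : ℤ → ℂ) *ᵥ η c) ∧
      g * g = 1 ∧ g.transpose * k3Gram * g = k3Gram ∧ g.map (Int.cast : ℤ → ℂ) *ᵥ x = x := by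
  obtain ⟨g, hg⟩ := exists_intMatrix_map_of_marking ι η hint
  set gC : Matrix K3Index K3Index ℂ := g.map (Int.cast : ℤ → ℂ) with hgC
  -- `g v` for an arbitrary vector `v ∈ Λ_ℂ`
  have hgv : ∀ v : K3Index → ℂ, gC *ᵥ v =
      η (HodgeTheory.complexBetti.map ι (2 * 1) (η.symm v)) := fun v => by
    rw [hg, LinearEquiv.apply_symm_apply]
  -- `g² = 1`
  have hgg : ∀ v : K3Index → ℂ, gC *ᵥ (gC *ᵥ v) = v := fun v => by
    rw [hgv v, ← hg, hι.map_map, LinearEquiv.apply_symm_apply]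
  have hsq : g * g = 1 := by
    refine Matrix.map_injective (Int.cast_injective (α := ℂ)) ?_
    change (g * g).map (Int.castRingHom ℂ) = (1 : Matrix K3Index K3Index ℤ).map (Int.castRingHom ℂ)
    rw [Matrix.map_mul, Matrix.map_one _ (map_zero _) (map_one _)]
    refine Matrix.toLin'.injective (LinearMap.ext fun v => ?_)
    rw [Matrix.toLin'_apply, Matrix.toLin'_one, LinearMap.id_apply, ← Matrix.mulVec_mulVec]
    exact hgg v
  -- `g x = x`
  have hgx : gC *ᵥ x = x := by
    rw [hgv, hι.isSymplectic _ h20, LinearEquiv.apply_symm_apply]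
  -- `ι^* p = n p`
  obtain ⟨n, hn⟩ := hgen _ (isIntegralClass_complexBetti_map ι hp)
  have hn' : HodgeTheory.complexBetti.map ι (2 * 2) p = (n : ℂ) • p := by
    rw [hn, Int.cast_smul_eq_zsmul]
  -- naturality of the cup product, read in the marking
  have hform : ∀ v w : K3Index → ℂ, k3Form (gC *ᵥ v) (gC *ᵥ w) = n * k3Form v w := by
    intro v w
    have h := cupProduct_map (Motives.AlgPoints.mapContinuous (L := ℂ) ι)
      (rfl : 2 * 1 + 2 * 1 = 2 * 2) (η.symm v) (η.symm w)
    change HodgeTheory.complexBetti.map ι (2 * 2) (cupProduct rfl (η.symm v) (η.symm w)) =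
      cupProduct rfl (HodgeTheory.complexBetti.map ι (2 * 1) (η.symm v))
        (HodgeTheory.complexBetti.map ι (2 * 1) (η.symm w)) at h
    rw [hcup, hcup, map_smul, hn', hg, hg, LinearEquiv.apply_symm_apply,
      LinearEquiv.apply_symm_apply, smul_smul] at h
    -- h : (k3Form v w * n) • p = k3Form (g v) (g w) • p
    have h' := sub_eq_zero.2 h
    rw [← sub_smul, smul_eq_zero] at h'
    rcases h' with h' | h'
    · rw [mul_comm] at h'; exact (sub_eq_zero.1 h').symm
    · exact absurd h' hp0
  -- `n = 1`: evaluate on `x̄, x`, both fixed by the real matrix `g`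
  have hgxbar : gC *ᵥ star x = star x := by
    rw [hgC, ← star_intCast_map_mulVec, ← hgC, hgx]
  have hn1 : (n : ℂ) = 1 := by
    have h := hform (star x) x
    rw [hgx, hgxbar] at h
    have hne : k3Form (star x) x ≠ 0 := fun h0 => by
      rw [h0, Complex.zero_re] at hxpos; exact lt_irrefl _ hxpos
    have : ((n : ℂ) - 1) * k3Form (star x) x = 0 := by rw [sub_mul, one_mul, ← h, sub_self]
    rcases mul_eq_zero.1 this with h1 | h1
    · exact sub_eq_zero.1 h1
    · exact absurd h1 hne
  -- `gᵀ Λ g = Λ`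
  have hiso : g.transpose * k3Gram * g = k3Gram := by
    refine Matrix.map_injective (Int.cast_injective (α := ℂ)) ?_
    change (g.transpose * k3Gram * g).map (Int.castRingHom ℂ) = k3Gram.map (Int.castRingHom ℂ)
    rw [Matrix.map_mul, Matrix.map_mul, Matrix.transpose_map]
    ext i j
    -- `(g e_i.g e_j) = (gᵀ Λ g) i j` and `(e_i.e_j) = Λ i j`
    have h := hform (Pi.single i 1) (Pi.single j 1)
    rw [hn1, one_mul, hgC, k3Form_mulVec_mulVec, k3Form_eq_dotProduct] at h
    simp only [Matrix.mulVec_single_one, single_one_dotProduct, Matrix.col_apply] at h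
    exact h
  exact ⟨g, hg, hsq, hiso, hgx⟩

/-- **Markings form an `O(Λ_{K3})`-torsor: composing a marking with an integral isometry is a
marking.** If `η : H²(S(ℂ); ℂ) ≃ Λ_ℂ` identifies the integral classes with `ℤ²²` and the cup
product with `(η a.η b) p`, and `γ` is an integral isometry of `Λ_{K3}` (`γᵀ Λ γ = Λ`; invertible
over `ℤ` by unimodularity, `isUnit_of_k3Isometry`), then `γ ∘ η` has the same two properties
(Huybrechts Ch. 6 §3.2: `O(Λ)` acts on marked K3 surfaces by `(X, φ) ↦ (X, γ ∘ φ)`).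
[cite: Huybrechts2016K3, Ch. 6 §3.2 (the action of `O(Λ)` on `N`)] -/
theorem exists_marking_comp_latticeIsometry
    {γ : Matrix K3Index K3Index ℤ} (hγ : γ.transpose * k3Gram * γ = k3Gram)
    (η : HodgeTheory.complexBetti S (2 * 1) ≃ₗ[ℂ] (K3Index → ℂ))
    (p : HodgeTheory.complexBetti S (2 * 2))
    (hint : ∀ c : HodgeTheory.complexBetti S (2 * 1),
      HodgeTheory.IsIntegralClass c ↔ ∃ v : K3Index → ℤ, η c = fun i => (v i : ℂ))
    (hcup : ∀ a b : HodgeTheory.complexBetti S (2 * 1),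
      cupProduct (rfl : 2 * 1 + 2 * 1 = 2 * 2) a b = k3Form (η a) (η b) • p) :
    ∃ φ : HodgeTheory.complexBetti S (2 * 1) ≃ₗ[ℂ] (K3Index → ℂ),
      (∀ c, φ c = γ.map (Int.cast : ℤ → ℂ) *ᵥ η c) ∧
      (∀ c : HodgeTheory.complexBetti S (2 * 1),
        HodgeTheory.IsIntegralClass c ↔ ∃ v : K3Index → ℤ, φ c = fun i => (v i : ℂ)) ∧
      (∀ a b : HodgeTheory.complexBetti S (2 * 1),
        cupProduct (rfl : 2 * 1 + 2 * 1 = 2 * 2) a b = k3Form (φ a) (φ b) • p) := by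
  obtain ⟨u, rfl⟩ := isUnit_of_k3Isometry hγ
  set gC : Matrix K3Index K3Index ℂ := (u : Matrix K3Index K3Index ℤ).map (Int.cast : ℤ → ℂ)
    with hgC
  set g'C : Matrix K3Index K3Index ℂ := (↑u⁻¹ : Matrix K3Index K3Index ℤ).map (Int.cast : ℤ → ℂ)
    with hg'C
  have hcast : ∀ M N : Matrix K3Index K3Index ℤ, M * N = 1 →
      M.map (Int.cast : ℤ → ℂ) * N.map (Int.cast : ℤ → ℂ) = 1 := by
    intro M N hMN
    have h := congrArg (Int.castRingHom ℂ).mapMatrix hMN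
    rw [map_mul, map_one] at h
    simpa only [RingHom.mapMatrix_apply, Int.coe_castRingHom] using h
  have hmul : gC * g'C = 1 := hcast _ _ u.mul_inv
  have hmul' : g'C * gC = 1 := hcast _ _ u.inv_mul
  let e : (K3Index → ℂ) ≃ₗ[ℂ] (K3Index → ℂ) :=
    LinearEquiv.ofLinear (Matrix.toLin' gC) (Matrix.toLin' g'C)
      (by rw [← Matrix.toLin'_mul, hmul, Matrix.toLin'_one])
      (by rw [← Matrix.toLin'_mul, hmul', Matrix.toLin'_one])
  have he : ∀ y, e y = gC *ᵥ y := fun y => Matrix.toLin'_apply gC y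
  refine ⟨η.trans e, fun c => by rw [LinearEquiv.trans_apply, he], ?_, ?_⟩
  · intro c
    rw [hint, LinearEquiv.trans_apply, he]
    constructor
    · rintro ⟨v, hv⟩
      exact ⟨(u : Matrix K3Index K3Index ℤ) *ᵥ v, by rw [hv, hgC, intCast_map_mulVec]⟩
    · rintro ⟨w, hw⟩
      refine ⟨(↑u⁻¹ : Matrix K3Index K3Index ℤ) *ᵥ w, ?_⟩
      have hc : η c = g'C *ᵥ (gC *ᵥ η c) := by
        rw [Matrix.mulVec_mulVec, hmul', Matrix.one_mulVec]
      rw [hc, hw, hg'C, intCast_map_mulVec]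
  · intro a b
    rw [hcup, LinearEquiv.trans_apply, LinearEquiv.trans_apply, he, he,
      k3Form_mulVec_mulVec_of_isometry hγ]

/-- **van Geemen–Sarti §1.2, the transport step ("Thus …"), proved.** If every K3 surface `S` with a
Nikulin involution `ι` admits SOME marking `(η, p)` (integral classes `↔ ℤ²²`, `a ∪ b = (η a.η b) p`,
`p` an integral generator of `H⁴`) together with an integral isometry `γ ∈ O(Λ_{K3})` conjugating
`ι^*` (read through `η`) to the swap of the two `E₈(−1)` blocks — `γ η ι^* = swap ∘ γ η`, which is
what Nikulin's uniqueness theorem (§1.1; Huybrechts Ch. 15 Thm. 3.13) combined with Morrison's model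
(Thm. 5.7) provides — then `Nikulin_involution_marking` holds: `φ := γ ∘ η` is a marking in which
`ι^*` is the block swap. [cite: VanGeemenSarti2007, §1.1 and §1.2] [cite: Morrison1984, Thm. 5.7]
[cite: Huybrechts2016K3, Ch. 15 Thm. 3.13 and Ch. 6 §3.2] -/
theorem Nikulin_involution_marking_of_conjugate
    (h : ∀ (S : Motives.SchemeOver ℂ), IsK3Surface S → ∀ ι : S ⟶ S, IsNikulinInvolution S ι →
      ∃ (η : HodgeTheory.complexBetti S (2 * 1) ≃ₗ[ℂ] (K3Index → ℂ))
        (p : HodgeTheory.complexBetti S (2 * 2)) (γ : Matrix K3Index K3Index ℤ),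
        HodgeTheory.IsIntegralClass p ∧
        (∀ q : HodgeTheory.complexBetti S (2 * 2), HodgeTheory.IsIntegralClass q → ∃ n : ℤ, q = n • p) ∧
        (∀ c : HodgeTheory.complexBetti S (2 * 1),
            HodgeTheory.IsIntegralClass c ↔ ∃ v : K3Index → ℤ, η c = fun i => (v i : ℂ)) ∧
        (∀ a b : HodgeTheory.complexBetti S (2 * 1),
            cupProduct (rfl : 2 * 1 + 2 * 1 = 2 * 2) a b = k3Form (η a) (η b) • p) ∧
        γ.transpose * k3Gram * γ = k3Gram ∧
        ∀ c : HodgeTheory.complexBetti S (2 * 1),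
          γ.map (Int.cast : ℤ → ℂ) *ᵥ η (HodgeTheory.complexBetti.map ι (2 * 1) c) =
            fun i => (γ.map (Int.cast : ℤ → ℂ) *ᵥ η c) (k3BlockSwap i)) :
    Nikulin_involution_marking := by
  intro S hS ι hι
  obtain ⟨η, p, γ, hp, hgen, hint, hcup, hγ, hconj⟩ := h S hS ι hι
  obtain ⟨φ, hφ, hint', hcup'⟩ := exists_marking_comp_latticeIsometry hγ η p hint hcup
  refine ⟨φ, p, hp, hgen, hint', hcup', fun c => ?_⟩
  rw [hφ, hφ, hconj]

/-- **The transport step loses nothing**: `Nikulin_involution_marking` is EQUIVALENT to the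
hypothesis of `Nikulin_involution_marking_of_conjugate` (conversely take `γ = 1`). So the remaining
debt of the fact is exactly "a marking plus a conjugating isometry", i.e. Huybrechts Ch. 1 Prop. 3.5
(`Huybrechts_K3_marking_exists`) plus Nikulin's uniqueness of the action / Morrison's model.
[cite: VanGeemenSarti2007, §1.1 and §1.2] [cite: Huybrechts2016K3, Ch. 15 Thm. 3.13] -/
theorem Nikulin_involution_marking_iff_exists_conjugate :
    Nikulin_involution_marking ↔
      ∀ (S : Motives.SchemeOver ℂ), IsK3Surface S → ∀ ι : S ⟶ S, IsNikulinInvolution S ι →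
        ∃ (η : HodgeTheory.complexBetti S (2 * 1) ≃ₗ[ℂ] (K3Index → ℂ))
          (p : HodgeTheory.complexBetti S (2 * 2)) (γ : Matrix K3Index K3Index ℤ),
          HodgeTheory.IsIntegralClass p ∧
          (∀ q : HodgeTheory.complexBetti S (2 * 2),
              HodgeTheory.IsIntegralClass q → ∃ n : ℤ, q = n • p) ∧
          (∀ c : HodgeTheory.complexBetti S (2 * 1),
              HodgeTheory.IsIntegralClass c ↔ ∃ v : K3Index → ℤ, η c = fun i => (v i : ℂ)) ∧
          (∀ a b : HodgeTheory.complexBetti S (2 * 1),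
              cupProduct (rfl : 2 * 1 + 2 * 1 = 2 * 2) a b = k3Form (η a) (η b) • p) ∧
          γ.transpose * k3Gram * γ = k3Gram ∧
          ∀ c : HodgeTheory.complexBetti S (2 * 1),
            γ.map (Int.cast : ℤ → ℂ) *ᵥ η (HodgeTheory.complexBetti.map ι (2 * 1) c) =
              fun i => (γ.map (Int.cast : ℤ → ℂ) *ᵥ η c) (k3BlockSwap i) := by
  refine ⟨fun hNM S hS ι hι => ?_, Nikulin_involution_marking_of_conjugate⟩
  obtain ⟨φ, p, hp, hgen, hint, hcup, hswap⟩ := hNM S hS ι hι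
  have h1 : (1 : Matrix K3Index K3Index ℤ).map (Int.cast : ℤ → ℂ) = 1 := by
    rw [Matrix.map_one Int.cast Int.cast_zero Int.cast_one]
  refine ⟨φ, p, 1, hp, hgen, hint, hcup, by rw [Matrix.transpose_one, Matrix.one_mul,
    Matrix.mul_one], fun c => ?_⟩
  rw [h1, Matrix.one_mulVec, Matrix.one_mulVec, hswap]

/-- **`Nikulin_involution_marking` from the tree's marking fact and Nikulin's uniqueness theorem in
lattice form, by name — the census of what `Nikulin_involution_marking_holds` still needs.**
Granted `Huybrechts_K3_marking_exists` (Huybrechts Ch. 1 Prop. 3.5: every K3 surface is marked,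
`(η, p, x)`) and — the remaining input — that for every such marked `S`, every Nikulin involution `ι`
of `S`, and the integral isometric involution `g` of `Λ_{K3}` through which `ι^*` acts (`g² = 1`,
`gᵀ Λ g = Λ`, `g x = x`: `IsNikulinInvolution.exists_latticeInvolution`), `g` is conjugate under
some `γ ∈ O(Λ_{K3})` to the swap of the two `E₈(−1)` blocks, `γ g = swap ∘ γ` (van Geemen–Sarti
§1.1: "any abelian group `G` which acts symplectically on a K3 surface has a unique, up to isometry,
action on `H²(X,ℤ)`" — Nikulin; with Morrison's model `(u,x,y) ↦ (u,y,x)`, Thm. 5.7; Huybrechts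
Ch. 15 Thm. 3.13, stated there without proof), the fact holds. The hypothesis `hN` is handed the
full marking package and all of `g`'s proved properties, so that it asks for no more than the
printed theorem. [cite: VanGeemenSarti2007, §1.1 and §1.2] [cite: Morrison1984, Thm. 5.7]
[cite: Huybrechts2016K3, Ch. 1 Prop. 3.5 and Ch. 15 Thm. 3.13] -/
theorem Nikulin_involution_marking_of_latticeConjugacy (hM : Huybrechts_K3_marking_exists)
    (hN : ∀ (S : Motives.SchemeOver ℂ), IsK3Surface S → ∀ ι : S ⟶ S, IsNikulinInvolution S ι →
      ∀ (η : HodgeTheory.complexBetti S (2 * 1) ≃ₗ[ℂ] (K3Index → ℂ))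
        (p : HodgeTheory.complexBetti S (2 * 2)) (x : K3Index → ℂ),
        p ≠ 0 →
        (HodgeTheory.IsIntegralClass p ∧
          (∀ q : HodgeTheory.complexBetti S (2 * 2),
              HodgeTheory.IsIntegralClass q → ∃ n : ℤ, q = n • p) ∧
          (∀ c : HodgeTheory.complexBetti S (2 * 1),
              HodgeTheory.IsIntegralClass c ↔ ∃ v : K3Index → ℤ, η c = fun i => (v i : ℂ)) ∧
          (∀ a b : HodgeTheory.complexBetti S (2 * 1),
              cupProduct (rfl : 2 * 1 + 2 * 1 = 2 * 2) a b = k3Form (η a) (η b) • p) ∧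
          HodgeTheory.IsOfHodgeType 2 S (2 * 1) 2 0 (LinearEquiv.symm η x) ∧
          (∀ τ : HodgeTheory.complexBetti S (2 * 1),
              HodgeTheory.IsOfHodgeType 2 S (2 * 1) 2 0 τ → ∃ t : ℂ, τ = t • LinearEquiv.symm η x)) →
        (k3Form x x = 0 ∧ 0 < (k3Form (star x) x).re ∧
          ∃ u : K3Index → ℤ, k3Form (fun i => (u i : ℂ)) x = 0 ∧
            0 < ∑ i, ∑ j, u i * k3Gram i j * u j) →
        ∀ g : Matrix K3Index K3Index ℤ,
          (∀ c : HodgeTheory.complexBetti S (2 * 1),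
              η (HodgeTheory.complexBetti.map ι (2 * 1) c) = g.map (Int.cast : ℤ → ℂ) *ᵥ η c) →
          g * g = 1 → g.transpose * k3Gram * g = k3Gram → g.map (Int.cast : ℤ → ℂ) *ᵥ x = x →
          ∃ γ : Matrix K3Index K3Index ℤ, γ.transpose * k3Gram * γ = k3Gram ∧
            ∀ v : K3Index → ℂ,
              γ.map (Int.cast : ℤ → ℂ) *ᵥ (g.map (Int.cast : ℤ → ℂ) *ᵥ v) =
                fun i => (γ.map (Int.cast : ℤ → ℂ) *ᵥ v) (k3BlockSwap i)) :
    Nikulin_involution_marking := by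
  refine Nikulin_involution_marking_of_conjugate fun S hS ι hι => ?_
  obtain ⟨η, p, x, hp0, hmk, hper⟩ := hM S hS
  obtain ⟨hp, hgen, hint, hcup, h20, hspan⟩ := hmk
  obtain ⟨g, hg, hsq, hiso, hgx⟩ :=
    hι.exists_latticeInvolution η p x hp0 hp hgen hint hcup h20 hper.2.1
  obtain ⟨γ, hγ, hconj⟩ :=
    hN S hS ι hι η p x hp0 ⟨hp, hgen, hint, hcup, h20, hspan⟩ hper g hg hsq hiso hgx
  exact ⟨η, p, γ, hp, hgen, hint, hcup, hγ, fun c => by rw [hg, hconj]⟩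

end Transport

end Literature.AlgebraicGeometry.Surfaces

end
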